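import Literature.AlgebraicGeometry.Resolution.BlowupRingExceptionalFibre
import Mathlib.RingTheory.Polynomial.UniqueFactorization
import Mathlib.RingTheory.IntegralClosure.IntegrallyClosed
import Mathlib.Algebra.CharP.Lemmas
import HarnessLib

/-!
# (L2) CLEANER DESCENT — part 1: the chart presentation `S[T_j : j ≠ i] → S[𝔪/x_i] ⊆ K`

Topic: `Summits/ResolutionOfSingularities/ResolutionOfSingularities/Theorems`. Chain W4.1 (crux `Steer`,
stmt-ResolutionOfSingularities-16345), §σ2.25 F-A3 Θ1♭ packaging (`StrippedThreadTwoN`, res-D-pv-003), lemma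
**(L2) CLEANER DESCENT** of res-L0-w41-tri-2's TRIAGE v9 (m7), res-L0-w41-plan-1 RULINGs 58b/63. This file is the
bookkeeping half; the descent itself is `FrobeniusClosingSteerCleanerDescent.lean`. No `Theses.*` / `Cruxes.*`
import (chain build rule); no definitions.

For a regular local subring `S ⊆ K` with regular system of parameters `z : Fin d → S` and `x₀ := z i ≠ 0`, the
chart ring `B = S[𝔪/x₀] = blowupRing S x₀ ⊆ K` is the image of the evaluation
`τ : S[T_j : j ≠ i] → K`, `T_j ↦ z_j / x₀` (`MvPolynomial.eval₂Hom S.subtype _`):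

* `eval₂Hom_mem_blowupRing`, `exists_eval₂Hom_eq_of_mem_blowupRing` — `τ(S[T]) = B`;
* `coeff_mem_maximalIdeal_of_eval₂Hom_eq_mul` / `exists_eval₂Hom_eq_mul_of_coeff_mem` — **the coefficient test**:
  `τ P ∈ x₀ · B` iff every coefficient of `P` lies in `𝔪_S` (Stacks 0BIQ; the tree's
  `blowupAlgebra.eval_mem_span_algebraMap_iff` for the quasi-regular sequence `z`, transported along the
  injection `blowupAlgebra (z) x₀ ↪ K` exactly as in `Literature/…/BlowupRingExceptionalFibre.lean`);
* `pow_mul_eval₂Hom_mem_of_totalDegree_le`, `exists_eval₂Hom_eq_div_pow_of_mem_pow` — **degree bookkeeping**: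
  `deg P ≤ n ⇒ x₀ⁿ · τ P ∈ S`, and `y ∈ 𝔪ⁿ ⇒ y / x₀ⁿ = τ P` with `deg P ≤ n`;
* `exists_eq_mul_of_pow_eq_pow_mul`, `mul_totalDegree_le_totalDegree_pow` — the step in `κ(S)[T]`: from
  `U ^ p = C ^ p · Φ`, `C ≠ 0` (characteristic `p`) get `U = C · W`, `W ^ p = Φ` (polynomial rings over a
  field are integrally closed) and `p · deg W ≤ deg Φ` (Frobenius acts on coefficients);
* `exists_map_residue_eq_of_totalDegree`, `map_residue_eq_zero_iff` — degree-preserving lifts along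
  `S[T] → κ(S)[T]` and its kernel `𝔪_S · S[T]`.

Everything here is OURS (campaign res-hironaka, rung L, slot W4.1); it replaces the role of no printed item and is
NOT a statement of the manuscript under review [claim: Hironaka2017, status: under-review]. Classical background:
Stacks Project Tag 0BIQ; Matsumura, *Commutative Ring Theory*, Thm. 17.10.
-/

set_option linter.dupNamespace false

noncomputable section

open IsLocalRing MvPolynomial Literature.AlgebraicGeometry.Resolution

namespace Summit.ResolutionOfSingularities.ResolutionOfSingularities.Theorems.SwitchingDichotomy.CleanerDescent

variable {K : Type} [Field K]

/-! ## The chart ring is the image of `S[T_j : j ≠ i]` -/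
section Chart

variable (S : Subring K) [IsRegularLocalRing S] {d : ℕ} (z : Fin d → S) (i : Fin d)

/-- Every value `P(z_j/x₀)` of the chart evaluation lies in `S[𝔪/x₀]` (`x₀ = z i`, all `z_j ∈ 𝔪_S`). [folklore] -/
theorem eval₂Hom_mem_blowupRing (hz : Ideal.span (Set.range z) = maximalIdeal S)
    (P : MvPolynomial {j : Fin d // j ≠ i} S) :
    MvPolynomial.eval₂Hom S.subtype (fun j : {j : Fin d // j ≠ i} => ((z j.1 : S) : K) / ((z i : S) : K)) P ∈
      blowupRing S ((z i : S) : K) := by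
  have hzm : ∀ j, z j ∈ maximalIdeal S := fun j => hz ▸ Ideal.subset_span ⟨j, rfl⟩
  induction P using MvPolynomial.induction_on with
  | C s =>
    rw [MvPolynomial.eval₂Hom_C]
    exact le_blowupRing S _ s.2
  | add p q hp hq =>
    rw [map_add]
    exact Subring.add_mem _ hp hq
  | mul_X p j hp =>
    rw [map_mul, MvPolynomial.eval₂Hom_X']
    exact Subring.mul_mem _ hp (div_mem_blowupRing _ (hzm j.1))

/-- Every element of the chart ring `S[𝔪/x₀]` is a value `P(z_j/x₀)` of the chart evaluation (`𝔪_S = (z)`,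
`z_i/x₀ = 1`). [folklore] -/
theorem exists_eval₂Hom_eq_of_mem_blowupRing (hz : Ideal.span (Set.range z) = maximalIdeal S) (hzi : z i ≠ 0)
    {b : K} (hb : b ∈ blowupRing S ((z i : S) : K)) :
    ∃ P : MvPolynomial {j : Fin d // j ≠ i} S,
      MvPolynomial.eval₂Hom S.subtype (fun j : {j : Fin d // j ≠ i} => ((z j.1 : S) : K) / ((z i : S) : K)) P
        = b := by
  classical
  have hx0 : ((z i : S) : K) ≠ 0 := fun h => hzi (Subtype.ext h)
  rw [blowupRing_eq_closure_of_span_eq ((z i : S) : K) (Set.range z) hz] at hb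
  induction hb using Subring.closure_induction with
  | mem y hy =>
    rcases hy with hy | ⟨w, ⟨j, rfl⟩, rfl⟩
    · exact ⟨MvPolynomial.C ⟨y, hy⟩, by rw [MvPolynomial.eval₂Hom_C]; rfl⟩
    · by_cases hj : j = i
      · subst hj
        exact ⟨1, by rw [map_one]; exact (div_self hx0).symm⟩
      · exact ⟨MvPolynomial.X ⟨j, hj⟩, by rw [MvPolynomial.eval₂Hom_X']⟩
  | zero => exact ⟨0, map_zero _⟩
  | one => exact ⟨1, map_one _⟩
  | add a b _ _ ha hb =>
    obtain ⟨P, rfl⟩ := ha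
    obtain ⟨Q, rfl⟩ := hb
    exact ⟨P + Q, map_add _ _ _⟩
  | neg a _ ha =>
    obtain ⟨P, rfl⟩ := ha
    exact ⟨-P, map_neg _ _⟩
  | mul a b _ _ ha hb =>
    obtain ⟨P, rfl⟩ := ha
    obtain ⟨Q, rfl⟩ := hb
    exact ⟨P * Q, map_mul _ _ _⟩

omit [IsRegularLocalRing S] in
/-- **Transport of the abstract affine blow-up algebra into `K`** (verbatim the first half of the proof of
`Literature.…blowupRing_chartQuotient`): the composite `blowupAlgebra (z) x₀ ⊆ S[1/x₀] → K` is injective, is the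
identity on `S`, and intertwines `blowupAlgebra.eval` with the chart evaluation `T_j ↦ z_j/x₀`. [folklore] -/
theorem exists_ringHom_blowupAlgebra_injective (hzi : z i ≠ 0) :
    ∃ g : blowupAlgebra (Ideal.span (Set.range z)) (z i) →+* K,
      Function.Injective g ∧
      (∀ s : S, g (algebraMap S (blowupAlgebra (Ideal.span (Set.range z)) (z i)) s) = (s : K)) ∧
      ∀ P : MvPolynomial {j : Fin d // j ≠ i} S, g (blowupAlgebra.eval z i P) =
        MvPolynomial.eval₂Hom S.subtype (fun j : {j : Fin d // j ≠ i} => ((z j.1 : S) : K) / ((z i : S) : K))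
          P := by
  -- adapted from Literature/AlgebraicGeometry/Resolution/BlowupRingExceptionalFibre.lean (`blowupRing_chartQuotient`)
  classical
  have hθ : ((z i : S) : K) ≠ 0 := fun h => hzi (Subtype.ext h)
  have hunit : IsUnit (S.subtype (z i)) := isUnit_iff_ne_zero.mpr hθ
  let Θ : Localization.Away (z i) →+* K := IsLocalization.Away.lift (z i) hunit
  have hΘalg : ∀ s : S, Θ (algebraMap S (Localization.Away (z i)) s) = (s : K) := fun s =>
    IsLocalization.Away.lift_eq (z i) hunit s
  have hΘinv : Θ (IsLocalization.Away.invSelf (z i)) = ((z i : S) : K)⁻¹ := by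
    apply eq_inv_of_mul_eq_one_left
    rw [← hΘalg (z i), ← map_mul, mul_comm, IsLocalization.Away.mul_invSelf, map_one]
  let g : blowupAlgebra (Ideal.span (Set.range z)) (z i) →+* K :=
    Θ.comp (blowupAlgebra (Ideal.span (Set.range z)) (z i)).val.toRingHom
  have hgalg : ∀ s : S, g (algebraMap S (blowupAlgebra (Ideal.span (Set.range z)) (z i)) s) = (s : K) :=
    fun s => hΘalg s
  have hgfrac : ∀ j : Fin d, g (blowupAlgebra.frac z i j) = ((z j : S) : K) / ((z i : S) : K) := by
    intro j
    change Θ ((blowupAlgebra.frac z i j : Localization.Away (z i))) = _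
    rw [blowupAlgebra.coe_frac, map_mul, hΘalg, hΘinv, div_eq_mul_inv]
  have hgeval : g.comp (blowupAlgebra.eval z i).toRingHom =
      MvPolynomial.eval₂Hom S.subtype
        (fun j : {j : Fin d // j ≠ i} => ((z j.1 : S) : K) / ((z i : S) : K)) := by
    refine (blowupAlgebra.comp_val_comp_eval z i Θ).trans ?_
    congr 1
    · ext s
      exact hΘalg s
    · funext j
      exact hgfrac j.1
  have hΘinj : ∀ w, Θ w = 0 → w = 0 := by
    intro w hw
    obtain ⟨⟨r, s⟩, hrs⟩ := IsLocalization.surj (Submonoid.powers (z i)) w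
    have hr : (r : K) = 0 := by
      have h := congrArg Θ hrs
      rw [map_mul, hw, zero_mul, hΘalg] at h
      exact h.symm
    have hr0 : r = 0 := Subtype.ext hr
    rw [hr0, map_zero] at hrs
    exact (IsUnit.mul_left_eq_zero (IsLocalization.map_units _ s)).mp hrs
  refine ⟨g, fun a b h => ?_, hgalg, fun P => ?_⟩
  · apply Subtype.ext
    have h0 : Θ ((a : Localization.Away (z i)) - b) = 0 := by
      rw [map_sub]
      exact sub_eq_zero.mpr h
    exact sub_eq_zero.mp (hΘinj _ h0)
  · rw [← hgeval]
    rfl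

/-- **Coefficient test, hard direction**: for a regular system of parameters `z` of the regular local subring
`S ⊆ K` and `x₀ = z i ≠ 0`, if `P(z_j/x₀) ∈ x₀ · S[𝔪/x₀]` then every coefficient of `P ∈ S[T_j : j ≠ i]` lies in
`𝔪_S` (Stacks 0BIQ: the relations of the chart modulo `x₀` are `𝔪_S · S[T]`; the tree's
`blowupAlgebra.eval_mem_span_algebraMap_iff` for the quasi-regular `z`, Matsumura Thm. 17.10).
[cite: StacksProject, Tag 0BIQ] -/
theorem coeff_mem_maximalIdeal_of_eval₂Hom_eq_mul (hd : (maximalIdeal S).spanFinrank = d)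
    (hz : Ideal.span (Set.range z) = maximalIdeal S) (hzi : z i ≠ 0)
    (P : MvPolynomial {j : Fin d // j ≠ i} S) {b : K} (hb : b ∈ blowupRing S ((z i : S) : K))
    (h : MvPolynomial.eval₂Hom S.subtype (fun j : {j : Fin d // j ≠ i} => ((z j.1 : S) : K) / ((z i : S) : K)) P
      = ((z i : S) : K) * b) :
    ∀ m, P.coeff m ∈ maximalIdeal S := by
  classical
  obtain ⟨g, hginj, hgalg, hgeval⟩ := exists_ringHom_blowupAlgebra_injective S z i hzi
  obtain ⟨Q, hQ⟩ := exists_eval₂Hom_eq_of_mem_blowupRing S z i hz hzi hb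
  have hqr : IsQuasiRegular z := isQuasiRegular_regularSystemOfParameters hd z hz
  have heq : blowupAlgebra.eval z i P =
      algebraMap S (blowupAlgebra (Ideal.span (Set.range z)) (z i)) (z i) * blowupAlgebra.eval z i Q := by
    apply hginj
    rw [map_mul, hgeval, hgeval, hgalg, hQ, h]
  have hmem : blowupAlgebra.eval z i P ∈
      Ideal.span {algebraMap S (blowupAlgebra (Ideal.span (Set.range z)) (z i)) (z i)} :=
    Ideal.mem_span_singleton'.mpr ⟨blowupAlgebra.eval z i Q, by rw [heq, mul_comm]⟩
  intro m
  rw [← hz]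
  exact (blowupAlgebra.eval_mem_span_algebraMap_iff z i hqr P).mp hmem m

/-- **Coefficient test, easy direction**: if every coefficient of `P ∈ S[T_j : j ≠ i]` lies in `𝔪_S` then
`P(z_j/x₀) ∈ x₀ · S[𝔪/x₀]`. [cite: StacksProject, Tag 0BIQ] -/
theorem exists_eval₂Hom_eq_mul_of_coeff_mem (hd : (maximalIdeal S).spanFinrank = d)
    (hz : Ideal.span (Set.range z) = maximalIdeal S) (hzi : z i ≠ 0)
    (P : MvPolynomial {j : Fin d // j ≠ i} S) (h : ∀ m, P.coeff m ∈ maximalIdeal S) :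
    ∃ b ∈ blowupRing S ((z i : S) : K),
      MvPolynomial.eval₂Hom S.subtype (fun j : {j : Fin d // j ≠ i} => ((z j.1 : S) : K) / ((z i : S) : K)) P
        = ((z i : S) : K) * b := by
  classical
  obtain ⟨g, -, hgalg, hgeval⟩ := exists_ringHom_blowupAlgebra_injective S z i hzi
  have hqr : IsQuasiRegular z := isQuasiRegular_regularSystemOfParameters hd z hz
  have hmem : blowupAlgebra.eval z i P ∈
      Ideal.span {algebraMap S (blowupAlgebra (Ideal.span (Set.range z)) (z i)) (z i)} :=
    (blowupAlgebra.eval_mem_span_algebraMap_iff z i hqr P).mpr (fun m => hz ▸ h m)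
  obtain ⟨β, hβ⟩ := Ideal.mem_span_singleton'.mp hmem
  obtain ⟨Q, rfl⟩ := blowupAlgebra.eval_surjective z i β
  refine ⟨_, eval₂Hom_mem_blowupRing S z i hz Q, ?_⟩
  rw [← hgeval P, ← hβ, map_mul, hgalg, hgeval, mul_comm]


/-! ## Degree bookkeeping: `deg P ≤ n ⇒ x₀ⁿ · P(z/x₀) ∈ S` and `𝔪ⁿ / x₀ⁿ = {P(z/x₀) : deg P ≤ n}` -/

omit [IsRegularLocalRing S] in
/-- A monomial of degree `≤ n` evaluated at `z_j/x₀` and multiplied by `x₀ⁿ` lies in `S`: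
`x₀ⁿ · a · ∏ (z_j/x₀)^{m_j} = a · ∏ z_j^{m_j} · x₀^{n - |m|}`. [folklore] -/
theorem pow_mul_eval₂Hom_monomial_mem (hzi : z i ≠ 0) {n : ℕ} (m : {j : Fin d // j ≠ i} →₀ ℕ) (a : S)
    (hm : (m.sum fun _ e => e) ≤ n) :
    ((z i : S) : K) ^ n *
        MvPolynomial.eval₂Hom S.subtype (fun j : {j : Fin d // j ≠ i} => ((z j.1 : S) : K) / ((z i : S) : K))
          (monomial m a) ∈ S := by
  classical
  have hx0 : ((z i : S) : K) ≠ 0 := fun h => hzi (Subtype.ext h)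
  obtain ⟨k, hk⟩ := Nat.exists_eq_add_of_le hm
  rw [MvPolynomial.eval₂Hom_monomial]
  have hprod : (m.prod fun j e => (((z j.1 : S) : K) / ((z i : S) : K)) ^ e) =
      (m.prod fun j e => ((z j.1 : S) : K) ^ e) / ((z i : S) : K) ^ (m.sum fun _ e => e) := by
    unfold Finsupp.prod Finsupp.sum
    simp_rw [div_pow]
    rw [Finset.prod_div_distrib, Finset.prod_pow_eq_pow_sum]
  have hZ : (m.prod fun j e => ((z j.1 : S) : K) ^ e) ∈ S := by
    unfold Finsupp.prod
    exact prod_mem fun j _ => pow_mem (z j.1).2 _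
  rw [hprod, hk, pow_add]
  have heq : ((z i : S) : K) ^ (m.sum fun _ e => e) * ((z i : S) : K) ^ k *
      (S.subtype a * ((m.prod fun j e => ((z j.1 : S) : K) ^ e) / ((z i : S) : K) ^ (m.sum fun _ e => e))) =
      (a : K) * (m.prod fun j e => ((z j.1 : S) : K) ^ e) * ((z i : S) : K) ^ k := by
    rw [Subring.coe_subtype]
    field_simp
  rw [heq]
  exact mul_mem (mul_mem a.2 hZ) (pow_mem (z i).2 k)

omit [IsRegularLocalRing S] in
/-- **Degree ⇒ denominators**: if `deg P ≤ n` then `x₀ⁿ · P(z_j/x₀) ∈ S`. [folklore] -/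
theorem pow_mul_eval₂Hom_mem_of_totalDegree_le (hzi : z i ≠ 0) {n : ℕ}
    (P : MvPolynomial {j : Fin d // j ≠ i} S) (hP : P.totalDegree ≤ n) :
    ((z i : S) : K) ^ n *
        MvPolynomial.eval₂Hom S.subtype (fun j : {j : Fin d // j ≠ i} => ((z j.1 : S) : K) / ((z i : S) : K)) P
      ∈ S := by
  classical
  rw [P.as_sum, map_sum, Finset.mul_sum]
  exact sum_mem fun m hm =>
    pow_mul_eval₂Hom_monomial_mem S z i hzi m (P.coeff m) ((le_totalDegree hm).trans hP)

/-- **Powers of `𝔪` ⇒ degrees**: every `y ∈ 𝔪_Sⁿ` is `y = x₀ⁿ · P(z_j/x₀)` for some `P ∈ S[T_j : j ≠ i]` of total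
degree `≤ n` (induction on `n`: `𝔪 = (z)` and `z_j = x₀ · (z_j/x₀)`). [folklore] -/
theorem exists_eval₂Hom_eq_div_pow_of_mem_pow (hz : Ideal.span (Set.range z) = maximalIdeal S) (hzi : z i ≠ 0) :
    ∀ (n : ℕ) (y : S), y ∈ maximalIdeal S ^ n →
      ∃ P : MvPolynomial {j : Fin d // j ≠ i} S, P.totalDegree ≤ n ∧
        MvPolynomial.eval₂Hom S.subtype (fun j : {j : Fin d // j ≠ i} => ((z j.1 : S) : K) / ((z i : S) : K)) P
          = (y : K) / ((z i : S) : K) ^ n := by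
  classical
  have hx0 : ((z i : S) : K) ≠ 0 := fun h => hzi (Subtype.ext h)
  intro n
  induction n with
  | zero =>
    intro y _
    exact ⟨MvPolynomial.C y, by rw [totalDegree_C], by rw [MvPolynomial.eval₂Hom_C, pow_zero, div_one]; rfl⟩
  | succ n ih =>
    intro y hy
    rw [pow_succ] at hy
    refine Submodule.mul_induction_on hy (fun a ha b hb => ?_) (fun u v hu hv => ?_)
    · obtain ⟨Pa, hdega, hPa⟩ := ih a ha
      rw [← hz, Ideal.mem_span_range_iff_exists_fun] at hb
      obtain ⟨c, hc⟩ := hb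
      -- the degree-`≤ 1` polynomial `c_i + Σ_{j ≠ i} c_j T_j` evaluates to `b / x₀`
      let Pb : MvPolynomial {j : Fin d // j ≠ i} S :=
        MvPolynomial.C (c i) + ∑ j : {j : Fin d // j ≠ i}, MvPolynomial.C (c j.1) * MvPolynomial.X j
      have hdegb : Pb.totalDegree ≤ 1 := by
        refine (totalDegree_add _ _).trans (max_le (by rw [totalDegree_C]; exact zero_le_one) ?_)
        refine totalDegree_finsetSum_le fun j _ => (totalDegree_mul _ _).trans ?_
        rw [totalDegree_C, totalDegree_X, zero_add]
      have hPb : MvPolynomial.eval₂Hom S.subtype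
          (fun j : {j : Fin d // j ≠ i} => ((z j.1 : S) : K) / ((z i : S) : K)) Pb =
            (b : K) / ((z i : S) : K) := by
        rw [eq_div_iff hx0, ← hc]
        simp only [Pb, map_add, map_sum, map_mul, MvPolynomial.eval₂Hom_C, MvPolynomial.eval₂Hom_X',
          Subring.coe_subtype]
        push_cast
        rw [add_mul, Finset.sum_mul, ← Finset.add_sum_erase Finset.univ _ (Finset.mem_univ i),
          Finset.sum_subtype (Finset.univ.erase i) (p := fun j => j ≠ i) (by simp)]
        congr 1
        refine Finset.sum_congr rfl fun j _ => ?_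
        rw [mul_assoc, div_mul_cancel₀ _ hx0]
      refine ⟨Pa * Pb, (totalDegree_mul _ _).trans (Nat.add_le_add hdega hdegb), ?_⟩
      rw [map_mul, hPa, hPb, div_mul_div_comm, ← pow_succ]
      push_cast
      rfl
    · obtain ⟨Pu, hdu, hPu⟩ := hu
      obtain ⟨Pv, hdv, hPv⟩ := hv
      refine ⟨Pu + Pv, (totalDegree_add _ _).trans (max_le hdu hdv), ?_⟩
      rw [map_add, hPu, hPv, ← add_div]
      push_cast
      rfl

end Chart

/-! ## The step in `κ[T]`: `p`-th roots of polynomials and their degrees -/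
section Residue

/-- In a polynomial ring over a field (a UFD, hence integrally closed), `U ^ p = C ^ p · Φ` with `C ≠ 0` forces
`C ∣ U`: `U = C · W` with `W ^ p = Φ`. [folklore] -/
theorem exists_eq_mul_of_pow_eq_pow_mul {κ : Type} [Field κ] {σ : Type} [Fintype σ] [DecidableEq σ]
    {p : ℕ} (hp : p ≠ 0) {U C Φ : MvPolynomial σ κ} (hC : C ≠ 0) (h : U ^ p = C ^ p * Φ) :
    ∃ W : MvPolynomial σ κ, U = C * W ∧ W ^ p = Φ := by
  have hdvd : C ^ p ∣ U ^ p := ⟨Φ, h⟩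
  rw [IsIntegrallyClosed.pow_dvd_pow_iff hp] at hdvd
  obtain ⟨W, hW⟩ := hdvd
  refine ⟨W, hW, ?_⟩
  rw [hW, mul_pow] at h
  exact mul_left_cancel₀ (pow_ne_zero p hC) h

/-- **Frobenius acts on coefficients**: over a field of characteristic `p`, the coefficient of `T^{p·m}` in `W ^ p`
is `(coefficient of T^m in W) ^ p`. [folklore] -/
theorem coeff_smul_pow_char {κ : Type} [Field κ] (p : ℕ) [Fact p.Prime] [CharP κ p] {σ : Type}
    (W : MvPolynomial σ κ) (m : σ →₀ ℕ) : (W ^ p).coeff (p • m) = (W.coeff m) ^ p := by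
  classical
  have hp0 : p ≠ 0 := (Fact.out : p.Prime).ne_zero
  have hinj : ∀ n : σ →₀ ℕ, p • n = p • m → n = m := fun n h =>
    Finsupp.ext fun j => Nat.eq_of_mul_eq_mul_left (Nat.pos_of_ne_zero hp0) (by
      have := DFunLike.congr_fun h j
      simpa only [Finsupp.smul_apply, smul_eq_mul] using this)
  conv_lhs => rw [W.as_sum, sum_pow_char p, coeff_sum]
  simp_rw [monomial_pow, coeff_monomial]
  rw [Finset.sum_eq_single m]
  · rw [if_pos rfl]
  · intro n _ hne
    rw [if_neg fun h => hne (hinj n h)]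
  · intro hm
    rw [if_pos rfl, notMem_support_iff.mp hm, zero_pow hp0]

/-- **Degrees of `p`-th powers**: over a field of characteristic `p`, `p · deg W ≤ deg (W ^ p)` (the top monomial
`T^m` of `W` contributes `T^{p·m}` with coefficient `c^p ≠ 0`). [folklore] -/
theorem mul_totalDegree_le_totalDegree_pow {κ : Type} [Field κ] (p : ℕ) [Fact p.Prime] [CharP κ p] {σ : Type}
    (W : MvPolynomial σ κ) : p * W.totalDegree ≤ (W ^ p).totalDegree := by
  classical
  by_cases hW : W = 0
  · simp [hW]
  obtain ⟨m, hm, hdeg⟩ := Finset.exists_mem_eq_sup W.support (support_nonempty.mpr hW) fun s => s.sum fun _ e => e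
  have hne : (W ^ p).coeff (p • m) ≠ 0 := by
    rw [coeff_smul_pow_char p W m]
    exact pow_ne_zero _ (mem_support_iff.mp hm)
  have hsum : ((p • m).sum fun _ e => e) = p * m.sum fun _ e => e := by
    rw [Finsupp.sum_smul_index' (fun _ => rfl)]
    unfold Finsupp.sum
    simp only [smul_eq_mul, Finset.mul_sum]
  calc p * W.totalDegree = p * m.sum fun _ e => e := by rw [MvPolynomial.totalDegree, hdeg]
    _ = (p • m).sum fun _ e => e := hsum.symm
    _ ≤ (W ^ p).totalDegree := le_totalDegree (mem_support_iff.mpr hne)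

/-- The total degree does not increase under a change of coefficients. [folklore] -/
theorem totalDegree_map_le {R T : Type} [CommRing R] [CommRing T] {σ : Type} (f : R →+* T)
    (P : MvPolynomial σ R) : (MvPolynomial.map f P).totalDegree ≤ P.totalDegree :=
  Finset.sup_mono (support_map_subset f P)

/-- **Degree-preserving lifts along `R[T] → κ(R)[T]`** for a local ring `R`: every polynomial over the residue
field is the reduction of one over `R` of the same total degree (lift the coefficients). [folklore] -/
theorem exists_map_residue_eq_of_totalDegree {R : Type} [CommRing R] [IsLocalRing R] {σ : Type}
    (W : MvPolynomial σ (ResidueField R)) :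
    ∃ P : MvPolynomial σ R, MvPolynomial.map (residue R) P = W ∧ P.totalDegree ≤ W.totalDegree := by
  classical
  obtain ⟨sec, hsec⟩ : ∃ sec : ResidueField R → R, ∀ a, residue R (sec a) = a :=
    ⟨fun a => (residue_surjective a).choose, fun a => (residue_surjective a).choose_spec⟩
  refine ⟨∑ m ∈ W.support, monomial m (sec (W.coeff m)), ?_, ?_⟩
  · rw [map_sum]
    simp_rw [map_monomial, hsec]
    exact W.as_sum.symm
  · exact totalDegree_finsetSum_le fun m hm => (totalDegree_monomial_le _ _).trans (le_totalDegree hm)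

/-- The kernel of `R[T] → κ(R)[T]` for a local ring `R`: the polynomials with all coefficients in `𝔪_R`.
[folklore] -/
theorem map_residue_eq_zero_iff {R : Type} [CommRing R] [IsLocalRing R] {σ : Type} (P : MvPolynomial σ R) :
    MvPolynomial.map (residue R) P = 0 ↔ ∀ m, P.coeff m ∈ maximalIdeal R := by
  simp only [MvPolynomial.ext_iff, coeff_map, coeff_zero, residue_eq_zero_iff]

end Residue

end Summit.ResolutionOfSingularities.ResolutionOfSingularities.Theorems.SwitchingDichotomy.CleanerDescent

end
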